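import Summits.QuantumAdvantage.QuantumAdvantage.Theorems.NearExactIsExact.Negative.CaseAPQStructureFourteen
import Summits.QuantumAdvantage.QuantumAdvantage.Theorems.NearExactIsExact.Negative.CaseATranslateFourteen
import Summits.QuantumAdvantage.QuantumAdvantage.Theorems.NearExactIsExact.Negative.CaseAWindowFourteen
import Summits.QuantumAdvantage.QuantumAdvantage.Theorems.CubicForrelationNearExactIsExactBasisWithTwo
import Summits.QuantumAdvantage.QuantumAdvantage.Theorems.CubicForrelationNearExactIsExactLinearTransport
import Summits.QuantumAdvantage.QuantumAdvantage.Theorems.CubicForrelationNearExactIsExactTenBalancedA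
import Summits.QuantumAdvantage.QuantumAdvantage.Theorems.CubicForrelationNearExactIsExactThetaLadder
import Summits.QuantumAdvantage.QuantumAdvantage.Theorems.CubicForrelationNearExactIsExactFourteenSecondStructureB

/-!
# THEOREM CA-W, frame-free: no case-A type-O cubic pair on 14 bits has forrelation above `59/64`
# (NearExactIsExact, disprover gen 23)

Negative/structural theorem for the crux `CubicForrelation.NearExactIsExact` (item r2), finite slice `n = 14`.
HONEST FRAMING: a statement about cubic Boolean functions on 14 bits — NOT summit progress; no violation of
`NearExactIsExact`, no per-`n` value.

`caseA_false`: for cubic `f, g` on `14` bits with `W_g = 32u`, all `u(x)` odd ("type O") and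
`[⌊u/2⌋ odd] ≠ [⌊u/4⌋ odd]` everywhere ("case A"), `Φ(f,g) ≤ 59/64`.  This is the coordinate normal form
`CaseAWindowFourteen.caseA_window_false` with its frame hypothesis REMOVED.  Assembly:
1. `caseA_pq_structure`: the digit is `d = p·q ⊕ μ`, `p = B(·,e₁)`, `q = B(·,e₀)` additive, `μ` of degree `≤ 1`;
2. `stub_affineForm` + `ct_caseA_translate`: translating the pair by the linear part of `μ` makes `d = p·q ⊕ b`;
3. `stub_affineForm` on `p, q` gives covectors `c_p ≠ c_q` (non-zero), `stub_basisWithTwo` an invertible `N` with columns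
   `12, 13` equal to them, and `stub_linearTransport` (with `N'ᵀ, Nᵀ`) moves `p, q` onto the dual coordinates `12, 13`;
4. the coordinate reversal (`forrelation_comp_perm` with `Fin.revPerm`) puts them on coordinates `1, 0`;
5. `caseA_window_false` (with `λ ≡ b`) concludes.

Sources: [this work]; linear algebra over `𝔽₂` via the tree stubs cited.  Standard axioms only.
-/

set_option linter.dupNamespace false -- D-0017: single-problem summit ⇒ `QuantumAdvantage.QuantumAdvantage` by design

noncomputable section

namespace Summit.QuantumAdvantage.QuantumAdvantage.Theorems.NearExactIsExact.Negative.CaseAFrameFreeFourteen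

open Finset
open scoped Matrix
open Literature.Computability.QuantumComplexity
open Literature.Computability.QuantumComplexity.BuzetChailloux (bxor zeroVec zeroVec_bxor twist_zeroVec_right)
open Literature.Computability.QuantumComplexity.DerivativeWalsh (W)
open Summit.QuantumAdvantage.QuantumAdvantage.Theorems.CubicForrelation.NearExactIsExact
open Summit.QuantumAdvantage.QuantumAdvantage.Theorems.ExactPairsMaioranaMcFarland.Negative (ind ind_apply ind_injective)
open Summit.QuantumAdvantage.QuantumAdvantage.Theorems.CubicForrelation.ExactPairsMaioranaMcFarland (dnf_twist_eq_chi)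
open Summit.QuantumAdvantage.QuantumAdvantage.Theorems.SignedCubicForrelationNotPrBPP.Negative.HalfQuad (forrelation_comm)
open Summit.QuantumAdvantage.QuantumAdvantage.Theorems.SignedExactCubicForrelationNotPrBPP.Covariance
  (isDegLeFun_one_of_additive)
open Summit.QuantumAdvantage.QuantumAdvantage.Theorems.NearExactIsExact.Negative.CaseAPQStructureFourteen
  (caseA_pq_structure)
open Summit.QuantumAdvantage.QuantumAdvantage.Theorems.NearExactIsExact.Negative.CaseATranslateFourteen
  (ct_caseA_translate)
open Summit.QuantumAdvantage.QuantumAdvantage.Theorems.NearExactIsExact.Negative.CaseAWindowFourteen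
  (caseA_window_false)

variable {n : ℕ}

/-! ### Tools -/

/-- **Permutation covariance of the Walsh transform**: `W_{s ∘ P_σ}(x) = W_s(x ∘ σ)`. [folklore] -/
theorem ff_W_comp_perm (σ : Equiv.Perm (Fin n)) (s : (Fin n → Bool) → ℝ) (x : Fin n → Bool) :
    W (fun y => s (y ∘ σ)) x = W s (x ∘ σ) := by
  unfold W
  set e : (Fin n → Bool) ≃ (Fin n → Bool) := Equiv.arrowCongr σ.symm (Equiv.refl Bool) with he_def
  have he : ∀ x : Fin n → Bool, e x = x ∘ σ := fun x => by
    funext i; simp [he_def, Equiv.arrowCongr_apply]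
  have htw : ∀ x y : Fin n → Bool, twist (x ∘ σ) (y ∘ σ) = twist x y := fun x y => by
    unfold twist
    exact Equiv.prod_comp σ (fun l => if (x l && y l) then (-1 : ℝ) else 1)
  calc ∑ y, s (y ∘ σ) * twist y x = ∑ y, s (e y) * twist (e y) (x ∘ σ) := by
        refine sum_congr rfl fun y _ => ?_
        rw [he, htw]
    _ = ∑ y, s y * twist y (x ∘ σ) := Equiv.sum_comp e (fun y => s y * twist y (x ∘ σ))

/-- A coordinate permutation preserves the algebraic degree. [folklore] -/
theorem ff_isDegLeFun_comp_perm {d : ℕ} (σ : Equiv.Perm (Fin n)) {F : (Fin n → Bool) → Bool}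
    (hF : IsDegLeFun d F) : IsDegLeFun d (fun x => F (x ∘ σ)) :=
  fc_isDegLeFun_comp (D := 1) hF (fun x => x ∘ σ) (fun v => isDegLeFun_apply (σ v) le_rfl) (by omega)

/-- **A prescribed column becomes a dual coordinate.** If `Nᵀ N'ᵀ = 1` and column `j` of `N` is `c`, then after the
change of variables `x ↦ N'ᵀ x` the character `(−1)^{c·a}` reads the coordinate `x_j`. [linear algebra] -/
theorem ff_functional_coord (N N' : Matrix (Fin n) (Fin n) (ZMod 2)) (hMM : Nᵀ * N'ᵀ = 1) (c : Fin n → Bool)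
    (j : Fin n) (hN : N *ᵥ Pi.single j 1 = ind c) (x : Fin n → Bool) :
    twist c (fun i => decide ((N'ᵀ *ᵥ ind x) i = 1)) = if x j then -1 else 1 := by
  rw [dnf_twist_eq_chi, lt_ind_decide, ← hN, ← Matrix.vecMul_transpose, ← Matrix.dotProduct_mulVec,
    Matrix.mulVec_mulVec, hMM, Matrix.one_mulVec, single_dotProduct, one_mul, ind_apply]
  cases x j
  · rw [if_neg Bool.false_ne_true, if_neg Bool.false_ne_true, ZMod.val_zero, pow_zero]
  · rw [if_pos rfl, if_pos rfl, show (1 : ZMod 2).val = 1 from rfl, pow_one]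

/-- Reading the digit after the translation: from `(−1)^{d ⊕ w} = (−1)^b t` (`t = ±1` the translation character),
`([d] ↔ t = 1) ↔ [w ⊕ b]`. [bookkeeping] -/
theorem ff_digit_read (dx w b : Bool) (t : ℝ) (h : signOf (dx ^^ w) = signOf b * t) (ht : t = 1 ∨ t = -1) :
    ((dx = true ↔ t = 1)) ↔ (w ^^ b) = true := by
  rcases ht with rfl | rfl <;> cases dx <;> cases w <;> cases b <;> norm_num [signOf] at h <;> norm_num

/-- The sign form of an additive Boolean function vanishing at `0` is a pure character: `P(a) = [(−1)^{c·a} = −1]`.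
[folklore] -/
theorem ff_additive_twist (P : (Fin n → Bool) → Bool) (c : Fin n → Bool) (b : Bool)
    (h : ∀ a, signOf (P a) = signOf b * twist c a) (h0 : P zeroVec = false) (a : Fin n → Bool) :
    P a = true ↔ twist c a = -1 := by
  have hb : b = false := by
    have h1 := h zeroVec
    rw [h0, twist_zeroVec_right, mul_one] at h1
    revert h1; cases b <;> norm_num [signOf]
  have h1 := h a
  rw [hb] at h1
  rcases tc_twist_cases c a with ht | ht <;> rw [ht] at h1 ⊢ <;> revert h1 <;> cases P a <;> norm_num [signOf]

/-- `[v] ↔ ((−1)^{w} = −1)` forces `v = w`. [bookkeeping] -/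
theorem ff_bool_of_iff (v w : Bool) (h : v = true ↔ (if w = true then (-1 : ℝ) else 1) = -1) : v = w := by
  cases v <;> cases w <;> norm_num at h <;> norm_num

/-! ### The frame-free theorem -/

/-- **THEOREM CA-W (frame-free).** For cubic `f, g` on `14` bits with `W_g = 32u`, all `u(x)` odd and
`[⌊u/2⌋ odd] ≠ [⌊u/4⌋ odd]` everywhere (case A), the forrelation is at most `59/64`.  No coordinate frame is assumed:
the normal form of `caseA_window_false` is produced by a translation, a linear change of dual coordinates and a
coordinate reversal.  NOT summit progress. [this work] -/
theorem caseA_false (f g : (Fin (7 + 7) → Bool) → Bool) (hf : IsDegLeFun 3 f) (hg : IsDegLeFun 3 g)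
    (u : (Fin (7 + 7) → Bool) → ℤ) (hu : ∀ x, W (fun y => signOf (g y)) x = (2 : ℝ) ^ 5 * (u x : ℝ))
    (hodd : ∀ x, Odd (u x)) (hA : ∀ x, ¬ (Odd (u x / 2) ↔ Odd (u x / 2 / 2)))
    (hΦ : (59 / 64 : ℝ) < forrelation f g) : False := by
  classical
  -- Step 1: the digit is `p·q ⊕ μ` with `μ` affine.
  obtain ⟨e₀, e₁, he, -, hμ⟩ := caseA_pq_structure g hg u hu hodd hA
  set d : (Fin (7 + 7) → Bool) → Bool := fun a => decide (Odd (u a / 2)) with hd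
  set P : (Fin (7 + 7) → Bool) → Bool := fun a => (d zeroVec ^^ d a ^^ d e₁ ^^ d (bxor a e₁)) with hP
  set Q : (Fin (7 + 7) → Bool) → Bool := fun a => (d zeroVec ^^ d a ^^ d e₀ ^^ d (bxor a e₀)) with hQ
  have hd2 : IsDegLeFun 2 d := fd_digitOne g u hg hu
  have hPadd : ∀ a a', P (bxor a a') = (P a ^^ P a') := fun a a' => es_B_add_left d hd2 a a' e₁
  have hQadd : ∀ a a', Q (bxor a a') = (Q a ^^ Q a') := fun a a' => es_B_add_left d hd2 a a' e₀
  have hPe₀ : P e₀ = true := he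
  have hQe₁ : Q e₁ = true := (es_B_symm d e₁ e₀).trans he
  have hQe₀ : Q e₀ = false := es_B_self d e₀
  have hP0 : P zeroVec = false := by
    show (d zeroVec ^^ d zeroVec ^^ d e₁ ^^ d (bxor zeroVec e₁)) = false
    rw [zeroVec_bxor]; cases d zeroVec <;> cases d e₁ <;> rfl
  have hQ0 : Q zeroVec = false := by
    show (d zeroVec ^^ d zeroVec ^^ d e₀ ^^ d (bxor zeroVec e₀)) = false
    rw [zeroVec_bxor]; cases d zeroVec <;> cases d e₀ <;> rfl
  have hμ' : IsDegLeFun 1 (fun a => d a ^^ (P a && Q a)) := hμ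
  -- Step 2: affine forms of `μ`, `p`, `q`.
  obtain ⟨c, b, hcb⟩ := stub_affineForm (7 + 7) (fun a => d a ^^ (P a && Q a)) hμ'
  obtain ⟨cP, bP, hcP⟩ := stub_affineForm (7 + 7) P (isDegLeFun_one_of_additive hPadd)
  obtain ⟨cQ, bQ, hcQ⟩ := stub_affineForm (7 + 7) Q (isDegLeFun_one_of_additive hQadd)
  have hPtw : ∀ a, P a = true ↔ twist cP a = -1 := ff_additive_twist P cP bP hcP hP0
  have hQtw : ∀ a, Q a = true ↔ twist cQ a = -1 := ff_additive_twist Q cQ bQ hcQ hQ0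
  -- Step 3: translate the pair by `c`; afterwards the digit is `p·q ⊕ b`.
  obtain ⟨hf₁, hg₁, hu₁, hodd₁, hA₁, hΦ₁, hdig₁⟩ := ct_caseA_translate f g hf hg u hu hodd hA c
  set f₁ : (Fin (7 + 7) → Bool) → Bool := fun x => f x ^^ decide (Odd #(univ.filter fun i => x i && c i)) with hf₁d
  set g₁ : (Fin (7 + 7) → Bool) → Bool := fun y => g (bxor y c) with hg₁d
  set u₁ : (Fin (7 + 7) → Bool) → ℤ := fun x => if twist c x = 1 then u x else -u x with hu₁d
  have hu₁' : ∀ x, W (fun y => signOf (g₁ y)) x = (2 : ℝ) ^ 5 * (u₁ x : ℝ) := hu₁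
  have hodd₁' : ∀ x, Odd (u₁ x) := hodd₁
  have hA₁' : ∀ x, ¬ (Odd (u₁ x / 2) ↔ Odd (u₁ x / 2 / 2)) := hA₁
  have hΦ₁' : forrelation f₁ g₁ = forrelation f g := hΦ₁
  have hdig₁' : ∀ x, Odd (u₁ x / 2) ↔ (Odd (u x / 2) ↔ twist c x = 1) := hdig₁
  have hD₁ : ∀ x, Odd (u₁ x / 2) ↔ ((P x && Q x) ^^ b) = true := by
    intro x
    rw [hdig₁' x, show Odd (u x / 2) ↔ d x = true from decide_eq_true_iff.symm]
    exact ff_digit_read (d x) (P x && Q x) b (twist c x) (hcb x) (tc_twist_cases c x)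
  -- Step 4: an invertible `N` with columns `12, 13` equal to the covectors `c_p, c_q`.
  have hcP0 : ind cP ≠ 0 := by
    intro h0
    have hz : cP = zeroVec := ind_injective (h0.trans tb_ind_zeroVec.symm)
    have h1 := (hPtw e₀).1 hPe₀
    rw [hz, twist_comm, twist_zeroVec_right] at h1
    norm_num at h1
  have hcQ0 : ind cQ ≠ 0 := by
    intro h0
    have hz : cQ = zeroVec := ind_injective (h0.trans tb_ind_zeroVec.symm)
    have h1 := (hQtw e₁).1 hQe₁
    rw [hz, twist_comm, twist_zeroVec_right] at h1
    norm_num at h1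
  have hcPQ : ind cP ≠ ind cQ := by
    intro h
    have hcc : cP = cQ := ind_injective h
    have h1 := (hPtw e₀).1 hPe₀
    rw [hcc] at h1
    have h2 := (hQtw e₀).2 h1
    rw [hQe₀] at h2
    exact Bool.false_ne_true h2
  obtain ⟨N, N', hN'N, hNP, hNQ⟩ : ∃ N N' : Matrix (Fin (7 + 7)) (Fin (7 + 7)) (ZMod 2), N' * N = 1 ∧
      N *ᵥ Pi.single (⟨12, by norm_num⟩ : Fin (7 + 7)) 1 = ind cP ∧
      N *ᵥ Pi.single (⟨13, by norm_num⟩ : Fin (7 + 7)) 1 = ind cQ :=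
    stub_basisWithTwo 12 (ind cP) (ind cQ) hcP0 hcQ0 hcPQ
  have hMM : Nᵀ * N'ᵀ = 1 := by rw [← Matrix.transpose_mul, hN'N, Matrix.transpose_one]
  obtain ⟨hΦeq, hWeq⟩ := stub_linearTransport _ N'ᵀ Nᵀ hMM f₁ g₁
  simp only [Matrix.transpose_transpose] at hΦeq hWeq
  -- Step 5: the transported data; the digit now reads the dual coordinates `12, 13`.
  set f₂ : (Fin (7 + 7) → Bool) → Bool := fun x => f₁ (fun i => decide ((N'ᵀ *ᵥ ind x) i = 1)) with hf₂d
  set g₂ : (Fin (7 + 7) → Bool) → Bool := fun y => g₁ (fun i => decide ((N *ᵥ ind y) i = 1)) with hg₂d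
  set u₂ : (Fin (7 + 7) → Bool) → ℤ := fun x => u₁ (fun i => decide ((N'ᵀ *ᵥ ind x) i = 1)) with hu₂d
  have hrd : ∀ v : Fin (7 + 7) → ZMod 2, ind (fun i => decide (v i = 1)) = v := lt_ind_decide
  have hf₂ : IsDegLeFun 3 f₂ := nf_isDegLeFun_mulVec N'ᵀ (fun v i => decide (v i = 1)) hrd hf₁
  have hg₂ : IsDegLeFun 3 g₂ := nf_isDegLeFun_mulVec N (fun v i => decide (v i = 1)) hrd hg₁
  have hu₂ : ∀ x, W (fun y => signOf (g₂ y)) x = (2 : ℝ) ^ 5 * (u₂ x : ℝ) := fun x => (hWeq x).trans (hu₁' _)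
  have hodd₂ : ∀ x, Odd (u₂ x) := fun x => hodd₁' _
  have hA₂ : ∀ x, ¬ (Odd (u₂ x / 2) ↔ Odd (u₂ x / 2 / 2)) := fun x => hA₁' _
  have hΦ₂ : forrelation f₂ g₂ = forrelation f g := hΦeq.trans hΦ₁'
  have hD₂ : ∀ x : Fin (7 + 7) → Bool,
      Odd (u₂ x / 2) ↔ ((x ⟨12, by norm_num⟩ && x ⟨13, by norm_num⟩) ^^ b) = true := by
    intro x
    have h := hD₁ (fun i => decide ((N'ᵀ *ᵥ ind x) i = 1))
    have hPa : P (fun i => decide ((N'ᵀ *ᵥ ind x) i = 1)) = x ⟨12, by norm_num⟩ :=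
      ff_bool_of_iff _ _ (by rw [← ff_functional_coord N N' hMM cP ⟨12, by norm_num⟩ hNP x]; exact hPtw _)
    have hQa : Q (fun i => decide ((N'ᵀ *ᵥ ind x) i = 1)) = x ⟨13, by norm_num⟩ :=
      ff_bool_of_iff _ _ (by rw [← ff_functional_coord N N' hMM cQ ⟨13, by norm_num⟩ hNQ x]; exact hQtw _)
    rw [hPa, hQa] at h
    exact h
  -- Step 6: reverse the coordinates, so that the digit reads coordinates `1, 0`.
  have hf₃ : IsDegLeFun 3 (fun x => f₂ (x ∘ (Fin.revPerm : Equiv.Perm (Fin (7 + 7))))) :=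
    ff_isDegLeFun_comp_perm _ hf₂
  have hg₃ : IsDegLeFun 3 (fun y => g₂ (y ∘ (Fin.revPerm : Equiv.Perm (Fin (7 + 7))))) :=
    ff_isDegLeFun_comp_perm _ hg₂
  have hu₃ : ∀ x, W (fun y => signOf (g₂ (y ∘ (Fin.revPerm : Equiv.Perm (Fin (7 + 7)))))) x =
      (2 : ℝ) ^ 5 * ((u₂ (x ∘ (Fin.revPerm : Equiv.Perm (Fin (7 + 7)))) : ℤ) : ℝ) := fun x =>
    (ff_W_comp_perm (Fin.revPerm : Equiv.Perm (Fin (7 + 7))) (fun y => signOf (g₂ y)) x).trans (hu₂ _)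
  have hΦ₃ : forrelation (fun x => f₂ (x ∘ (Fin.revPerm : Equiv.Perm (Fin (7 + 7)))))
      (fun y => g₂ (y ∘ (Fin.revPerm : Equiv.Perm (Fin (7 + 7))))) = forrelation f g :=
    (forrelation_comp_perm _ f₂ g₂).trans hΦ₂
  have h12 : (Fin.revPerm : Equiv.Perm (Fin (7 + 7))) ⟨12, by norm_num⟩ = ⟨1, by norm_num⟩ := by decide
  have h13 : (Fin.revPerm : Equiv.Perm (Fin (7 + 7))) ⟨13, by norm_num⟩ = ⟨0, by norm_num⟩ := by decide
  have hD₃ : ∀ x : Fin (7 + 7) → Bool, Odd (u₂ (x ∘ (Fin.revPerm : Equiv.Perm (Fin (7 + 7)))) / 2) ↔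
      ((x ⟨1, by norm_num⟩ && x ⟨0, by norm_num⟩) ^^ b) = true := by
    intro x
    have h := hD₂ (x ∘ (Fin.revPerm : Equiv.Perm (Fin (7 + 7))))
    rw [Function.comp_apply, Function.comp_apply, h12, h13] at h
    exact h
  -- Step 7: the coordinate normal form of THEOREM CA-W.
  refine caseA_window_false _ _ hf₃ hg₃ (fun x => u₂ (x ∘ (Fin.revPerm : Equiv.Perm (Fin (7 + 7))))) hu₃
    (fun x => hodd₂ _) (fun x => hA₂ _) (fun _ => b) (fun p q a => ?_) (by rw [hΦ₃]; exact hΦ)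
  rw [hD₃]
  show ((q && p) ^^ b) = true ↔ ((p && q) ^^ b) = true
  rw [Bool.and_comm]


/-- **THEOREM CA-W (frame-free), inequality form**: a case-A type-O cubic pair on `14` bits has `Φ ≤ 59/64`.
NOT summit progress. [this work] -/
theorem caseA_forrelation_le (f g : (Fin (7 + 7) → Bool) → Bool) (hf : IsDegLeFun 3 f) (hg : IsDegLeFun 3 g)
    (u : (Fin (7 + 7) → Bool) → ℤ) (hu : ∀ x, W (fun y => signOf (g y)) x = (2 : ℝ) ^ 5 * (u x : ℝ))
    (hodd : ∀ x, Odd (u x)) (hA : ∀ x, ¬ (Odd (u x / 2) ↔ Odd (u x / 2 / 2))) :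
    forrelation f g ≤ 59 / 64 :=
  not_lt.mp fun h => caseA_false f g hf hg u hu hodd hA h


/-- **Sharpened second structure at `n = 14`.**  In `fo_second_structure_sharp` (cubic pairs with `15/16 ≤ Φ ≠ 1`), the
case-A alternatives of the type-O branch cannot occur (`caseA_false`: case A forces `Φ ≤ 59/64 < 15/16`, on either side by
the symmetry of `Φ`): a type-O pair near the top has digit quadratics of rank `≥ 4` on BOTH sides.  NOT summit progress.
[this work] -/
theorem second_structure_noCaseA (f g : (Fin (7 + 7) → Bool) → Bool) (hf : IsDegLeFun 3 f) (hg : IsDegLeFun 3 g)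
    (hΦ : (15 / 16 : ℝ) ≤ forrelation f g) (hne : forrelation f g ≠ 1) :
    (∃ u' : (Fin (7 + 7) → Bool) → ℤ, (∀ x, W (fun y => signOf (g y)) x = (2 : ℝ) ^ 6 * (u' x : ℝ)) ∧
      4096 ≤ #(univ.filter fun x : Fin (7 + 7) → Bool => Odd (u' x)) ∧
      #(univ.filter fun x : Fin (7 + 7) → Bool => Odd (u' x)) < 8192) ∨
    (∃ v' : (Fin (7 + 7) → Bool) → ℤ, (∀ y, W (fun x => signOf (f x)) y = (2 : ℝ) ^ 6 * (v' y : ℝ)) ∧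
      4096 ≤ #(univ.filter fun y : Fin (7 + 7) → Bool => Odd (v' y)) ∧
      #(univ.filter fun y : Fin (7 + 7) → Bool => Odd (v' y)) < 8192) ∨
    (∃ u v : (Fin (7 + 7) → Bool) → ℤ, (∀ x, W (fun y => signOf (g y)) x = (2 : ℝ) ^ 5 * (u x : ℝ)) ∧
      (∀ y, W (fun x => signOf (f x)) y = (2 : ℝ) ^ 5 * (v y : ℝ)) ∧ (∀ x, Odd (u x)) ∧ (∀ y, Odd (v y)) ∧
      #(univ.filter fun a : Fin (7 + 7) → Bool => ∀ b, (decide (Odd (u zeroVec / 2)) ^^ decide (Odd (u a / 2)) ^^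
          decide (Odd (u b / 2)) ^^ decide (Odd (u (bxor a b) / 2))) = false) < 2 ^ 12 ∧
      #(univ.filter fun a : Fin (7 + 7) → Bool => ∀ b, (decide (Odd (v zeroVec / 2)) ^^ decide (Odd (v a / 2)) ^^
          decide (Odd (v b / 2)) ^^ decide (Odd (v (bxor a b) / 2))) = false) < 2 ^ 12) := by
  have h15 : (59 / 64 : ℝ) < 15 / 16 := by norm_num
  rcases fo_second_structure_sharp f g hf hg hΦ hne with h | h | ⟨u, v, hu, hv, hou, hov, hru, hrv⟩
  · exact Or.inl h
  · exact Or.inr (Or.inl h)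
  · refine Or.inr (Or.inr ⟨u, v, hu, hv, hou, hov, ?_, ?_⟩)
    · rcases hru with hru | hAu
      · exact hru
      · exact (caseA_false f g hf hg u hu hou hAu (h15.trans_le hΦ)).elim
    · rcases hrv with hrv | hAv
      · exact hrv
      · have hΦ' : (15 / 16 : ℝ) ≤ forrelation g f := by rw [forrelation_comm]; exact hΦ
        exact (caseA_false g f hg hf v hv hov hAv (h15.trans_le hΦ')).elim

end Summit.QuantumAdvantage.QuantumAdvantage.Theorems.NearExactIsExact.Negative.CaseAFrameFreeFourteen

end
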